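import Summits.BirchSwinnertonDyer.BirchSwinnertonDyer.Theorems.ManinLocalTwoThreeCongruenceHomShiftInvariant
import Summits.BirchSwinnertonDyer.BirchSwinnertonDyer.Theorems.ManinLocalTwoThreeShiftInvariantHeckeEigenvalue
import HarnessLib

/-!
# Congruence cocycles killing the parabolic generators are Eisenstein over ANY coefficient ring (MEMO-es §23, replaces
# LEMMA D + HECKE-DIAMOND in the bottom step of E-es-25)

Summit `BirchSwinnertonDyer`, cruxes C3 `ManinPrimeToThreeAtNine` (stmt-BirchSwinnertonDyer-22968) / C2 `ManinOddAtFour`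
(stmt-22967), route `ManinLocalTwoThree` (cell bsd-f2-manin); registered stubs `stub_relativeIharaBar331` /
`stub_relativeIharaBarTwo` = the leaf `RelativeIharaShiftVanishingBar p t n`, now reduced (p3's
`Theorems/ManinLocalTwoThreeDiamondEisenstein.lean`, typer's bridge) to E-es-35 `ShiftInvariantIsDiamond`: a shift-invariant
generalised eigen-cocycle is Eisenstein or a DIAMOND function.  MEMO-es §23 obtains this at the bottom from the glued
homomorphism `δΦ` (kills every cusp-fixer; kills `Γ(M₀)` by the congruence subgroup property — tree theorem) via LEMMA D
(`δΦ` is a diamond function).  This file gives the Eisenstein conclusion DIRECTLY, without identifying `δΦ`: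
`shiftInvariant_of_congruence_of_killsUnipotents` — a degree-`0` cocycle factoring mod `M` which kills `(1 1; 0 1)` and
`(1 0; N 1)` is shift-invariant at EVERY `ℓ` (coefficient-free variant of the lead's `shiftInvariant_of_congruence`: the
unipotent corrections vanish identically), hence (`heckeU_eq_smul_of_shiftInvariant`) `T_ℓ u = (ℓ + 1) u` for every prime
`ℓ ∤ N` (`heckeU_eq_smul_of_congruence_of_killsUnipotents`, kernel form `…_of_killsCongruence_…`); the landed ends
(`eq_zero_or_eq_add_one_of_heckeDiamond`-type, or the lead's `eq_zero_of_killsCongruence_of_isHeckeGenEigenvector`) finish.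
Nothing about BSD or Manin's conjecture is proved here.
-/

set_option autoImplicit false
set_option linter.dupNamespace false

open scoped MatrixGroups

open CongruenceSubgroup Literature.NumberTheory.EllipticCurves.ModularForms
  Literature.NumberTheory.EllipticCurves.ModularForms.HidaCohomology

namespace Summit.BirchSwinnertonDyer.BirchSwinnertonDyer.Theorems.ManinLocalTwoThree

section Variant

variable {N M : ℕ} {R : Type*} [CommRing R]

/-- **Congruence homomorphisms killing the two unipotent generators are shift-invariant, over ANY coefficient ring.**
Variant of `shiftInvariant_of_congruence` in which the torsion condition on the coefficients is replaced by
`u(1 1; 0 1) = 0` and `u(1 0; N 1) = 0` (true for PARABOLIC cocycles and for the diamond functions `γ ↦ η(d_γ)`): if `u`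
factors through reduction modulo `M`, then `π_ℓ^* u = π_1^* u` on `Γ₀(L)` for every `ℓ ≥ 1` and every `L` with
`N ℓ ∣ L` (no coprimality needed: the unipotent corrections vanish identically).  Same explicit congruence
`(a, ℓb; c/ℓ, d) ≡ (1 0; s 1)(a b; c d)(1 r; 0 1) (mod M)` as there. [folklore] -/
theorem shiftInvariant_of_congruence_of_killsUnipotents [NeZero M] {u : Gamma0 N → Fin 1 → R} (hu : u ∈ cocycles 0 N R)
    (hF : ∀ γ₁ γ₂ : Gamma0 N, (∀ i j, ((gmat γ₁ i j : ℤ) : ZMod M) = ((gmat γ₂ i j : ℤ) : ZMod M)) → u γ₁ = u γ₂)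
    (hT : ∀ (T : SL(2, ℤ)) (hT : T ∈ Gamma0 N), T 0 0 = 1 → T 0 1 = 1 → T 1 0 = 0 → T 1 1 = 1 → u ⟨T, hT⟩ = 0)
    (hV : ∀ (V : SL(2, ℤ)) (hV : V ∈ Gamma0 N), V 0 0 = 1 → V 0 1 = 0 → V 1 0 = N → V 1 1 = 1 → u ⟨V, hV⟩ = 0)
    {ℓ : ℕ} [NeZero ℓ] {L : ℕ} (hL1 : N * 1 ∣ L) (hLℓ : N * ℓ ∣ L) :
    degeneracyPullback 0 N L ℓ R hLℓ u = degeneracyPullback 0 N L 1 R hL1 u := by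
  have hM0 : 0 < M := Nat.pos_of_ne_zero (NeZero.ne M)
  have hℓ0 : (ℓ : ℤ) ≠ 0 := by exact_mod_cast NeZero.ne ℓ
  -- the unipotent one-parameter families
  let Um : ℤ → SL(2, ℤ) := fun x ↦ ⟨!![1, x; 0, 1], by rw [Matrix.det_fin_two_of]; ring⟩
  let U : ℤ → Gamma0 N := fun x ↦ ⟨Um x, mem_Gamma0_of_dvd_apply_one_zero (Um x) (by simp [Um])⟩
  let Vm : ℤ → SL(2, ℤ) := fun y ↦ ⟨!![1, 0; (N : ℤ) * y, 1], by rw [Matrix.det_fin_two_of]; ring⟩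
  let V : ℤ → Gamma0 N := fun y ↦ ⟨Vm y, mem_Gamma0_of_dvd_apply_one_zero (Vm y) (by simp [Vm])⟩
  have hUadd : ∀ x y, U (x + y) = U x * U y := by
    intro x y
    apply Subtype.ext; ext i j
    fin_cases i <;> fin_cases j <;> simp [U, Um, Matrix.mul_apply, Fin.sum_univ_two, add_comm]
  have hVadd : ∀ x y, V (x + y) = V x * V y := by
    intro x y
    apply Subtype.ext; ext i j
    fin_cases i <;> fin_cases j <;> simp [V, Vm, Matrix.mul_apply, Fin.sum_univ_two, mul_add, add_comm]
  have hUlin : ∀ x, u (U x) = x • u (U 1) := cocycle_zero_apply_oneParam hu U hUadd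
  have hVlin : ∀ y, u (V y) = y • u (V 1) := cocycle_zero_apply_oneParam hu V hVadd
  have hmul : ∀ γ δ : Gamma0 N, u (γ * δ) = u γ + u δ := fun γ δ ↦ by
    rw [(mem_cocycles_iff.mp hu) γ δ, act_zero_eq_id, LinearMap.id_apply, add_comm]
  -- the two unipotent generators are killed, hence so are their one-parameter families
  have hU1 : u (U 1) = 0 := hT (Um 1) _ rfl rfl rfl rfl
  have hV1 : u (V 1) = 0 := hV (Vm 1) _ rfl rfl (by simp [Vm]) rfl
  have hU0 : ∀ k : ℤ, (k * ((ℓ : ℤ) - 1)) • u (U 1) = 0 := by intro k; rw [hU1, smul_zero]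
  have hV0 : ∀ k : ℤ, (k * ((ℓ : ℤ) - 1)) • u (V 1) = 0 := by intro k; rw [hV1, smul_zero]
  -- the two conjugates of `γ`
  funext γ
  rw [degeneracyPullback_zero_apply, degeneracyPullback_one_apply]
  set γ₁ : Gamma0 N := Gamma0.degeneracyConj N L 1 hL1 γ with hγ₁
  set γ₂ : Gamma0 N := Gamma0.degeneracyConj N L ℓ hLℓ γ with hγ₂
  set a : ℤ := (γ : SL(2, ℤ)) 0 0 with ha
  set b : ℤ := (γ : SL(2, ℤ)) 0 1 with hb
  set c : ℤ := (γ : SL(2, ℤ)) 1 0 with hc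
  set d : ℤ := (γ : SL(2, ℤ)) 1 1 with hd
  have hdet : a * d - b * c = 1 := by
    have h := Matrix.det_fin_two (γ : SL(2, ℤ)).1
    rw [(γ : SL(2, ℤ)).2] at h
    rw [ha, hb, hc, hd]; linarith
  -- `c = ℓ N c''`
  obtain ⟨c'', hc''⟩ : (N : ℤ) * ℓ ∣ c := by
    have hLc : (L : ℤ) ∣ c := by
      have h := γ.2
      rw [Gamma0_mem] at h
      exact (ZMod.intCast_zmod_eq_zero_iff_dvd _ L).mp h
    exact (show (N : ℤ) * ℓ ∣ (L : ℤ) by exact_mod_cast hLℓ).trans hLc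
  -- entries of `γ₁`, `γ₂`
  have e₁ : gmat γ₁ = !![a, b; c, d] := by
    rw [gmat, hγ₁, Gamma0.coe_degeneracyConj_one]
    ext i j; fin_cases i <;> fin_cases j <;> rfl
  have e₂ : gmat γ₂ = !![a, (ℓ : ℤ) * b; (N : ℤ) * c'', d] := by
    ext i j
    fin_cases i <;> fin_cases j
    · simp [gmat, hγ₂, Gamma0.degeneracyConjElt, ha]
    · simp [gmat, hγ₂, Gamma0.degeneracyConjElt, hb]
    · simp only [gmat, hγ₂, Gamma0.degeneracyConj_apply]
      change c / ℓ = _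
      rw [hc'', show (N : ℤ) * ℓ * c'' = ℓ * (N * c'') by ring, Int.mul_ediv_cancel_left _ hℓ0]
      rfl
    · simp [gmat, hγ₂, Gamma0.degeneracyConjElt, hd]
  -- Step 1: make `a` a unit modulo `M`
  have hac : IsCoprime a c := ⟨d, -b, by linear_combination hdet⟩
  obtain ⟨x, hx⟩ := exists_isCoprime_add_mul a c hac M hM0
  obtain ⟨astar, q, hq⟩ := hx
  set at' : ℤ := a + x * c with hat
  set bt : ℤ := b + x * d with hbt
  set γt₁ : Gamma0 N := U x * γ₁ with hγt₁
  set γt₂ : Gamma0 N := U (ℓ * x) * γ₂ with hγt₂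
  have et₁ : gmat γt₁ = !![at', bt; c, d] := by
    rw [hγt₁, gmat_mul, e₁]
    ext i j; fin_cases i <;> fin_cases j <;> simp [gmat, U, Um, Matrix.mul_apply, Fin.sum_univ_two, hat, hbt]
  have et₂ : gmat γt₂ = !![at', (ℓ : ℤ) * bt; (N : ℤ) * c'', d] := by
    rw [hγt₂, gmat_mul, e₂]
    ext i j
    fin_cases i <;> fin_cases j <;> simp [gmat, U, Um, Matrix.mul_apply, Fin.sum_univ_two, hat, hbt]
    · linear_combination (-x) * hc''
    · ring
  -- Step 2: the explicit congruence `γt₂ ≡ V y · γt₁ · U r (mod M)`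
  set r : ℤ := ((ℓ : ℤ) - 1) * astar * bt with hr
  set y : ℤ := c'' * (1 - (ℓ : ℤ)) * astar with hy
  set Z : Gamma0 N := V y * γt₁ * U r with hZ
  have eZ : gmat Z = !![at', at' * r + bt; (N : ℤ) * y * at' + c, ((N : ℤ) * y * at' + c) * r + (N : ℤ) * y * bt + d] := by
    rw [hZ, gmat_mul, gmat_mul, et₁]
    ext i j
    fin_cases i <;> fin_cases j <;> simp [gmat, U, Um, V, Vm, Matrix.mul_apply, Fin.sum_univ_two]
    ring
  have hcong : ∀ i j, ((gmat γt₂ i j : ℤ) : ZMod M) = ((gmat Z i j : ℤ) : ZMod M) := by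
    intro i j
    rw [et₂, eZ, ZMod.intCast_eq_intCast_iff_dvd_sub]
    fin_cases i <;> fin_cases j <;>
      simp only [Fin.zero_eta, Fin.mk_one, Fin.isValue, Matrix.of_apply, Matrix.cons_val_zero,
        Matrix.cons_val_one]
    · simp
    · exact ⟨-((ℓ : ℤ) - 1) * bt * q, by linear_combination at' * hr + ((ℓ : ℤ) - 1) * bt * hq⟩
    · exact ⟨(N : ℤ) * c'' * ((ℓ : ℤ) - 1) * q, by
        linear_combination (N : ℤ) * at' * hy + hc'' + (N : ℤ) * c'' * (1 - (ℓ : ℤ)) * hq⟩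
    · exact ⟨-r * (N : ℤ) * c'' * (1 - (ℓ : ℤ)) * q, by
        linear_combination (N : ℤ) * (r * at' + bt) * hy + r * hc'' + (N : ℤ) * c'' * hr +
          r * (N : ℤ) * c'' * (1 - (ℓ : ℤ)) * hq⟩
  -- Step 3: evaluate `u`
  have huZ : u γt₂ = u γt₁ := by
    rw [hF γt₂ Z hcong, hZ, hmul, hmul, hVlin, hUlin,
      show y = (-(c'' * astar)) * ((ℓ : ℤ) - 1) by rw [hy]; ring, hV0,
      show r = (astar * bt) * ((ℓ : ℤ) - 1) by rw [hr]; ring, hU0, zero_add, add_zero]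
  have hUx : u (U ((ℓ : ℤ) * x)) = u (U x) := by
    rw [hUlin, hUlin x, ← sub_eq_zero, ← sub_smul, show (ℓ : ℤ) * x - x = x * ((ℓ : ℤ) - 1) by ring, hU0]
  rw [hγt₂, hγt₁, hmul, hmul, hUx] at huZ
  exact add_left_cancel huZ



end Variant

/-! ### The use: a congruence cocycle killing the parabolic generators has `T_ℓ = ℓ + 1` (replaces LEMMA D) -/

section Eisenstein

variable {N M : ℕ} {R : Type*} [CommRing R]

/-- **A congruence cocycle killing `(1 1; 0 1)` and `(1 0; N 1)` is `T_ℓ`-Eisenstein at every prime `ℓ ∤ N`**, over ANY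
coefficient ring: if `u ∈ Z⁰(Γ₀(N), R)` factors through reduction mod `M` and kills the two unipotent generators, then
`heckeU u = (ℓ + 1) • u` for every prime `ℓ ∤ N` (no coprimality with `M` needed).  This is what MEMO-es §23's bottom uses
LEMMA D (E-es-32 `DiamondOfKillsUnipotents`) + HECKE-DIAMOND for: the glued homomorphism `δΦ` kills every cusp-fixer and,
by the congruence subgroup property, a principal congruence subgroup — so it is Eisenstein without identifying it as a
diamond function. [folklore] -/
theorem heckeU_eq_smul_of_congruence_of_killsUnipotents [NeZero M] {u : Gamma0 N → Fin 1 → R}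
    (hu : u ∈ cocycles 0 N R)
    (hF : ∀ γ₁ γ₂ : Gamma0 N, (∀ i j, ((gmat γ₁ i j : ℤ) : ZMod M) = ((gmat γ₂ i j : ℤ) : ZMod M)) → u γ₁ = u γ₂)
    (hT : ∀ (T : SL(2, ℤ)) (hT : T ∈ Gamma0 N), T 0 0 = 1 → T 0 1 = 1 → T 1 0 = 0 → T 1 1 = 1 → u ⟨T, hT⟩ = 0)
    (hV : ∀ (V : SL(2, ℤ)) (hV : V ∈ Gamma0 N), V 0 0 = 1 → V 0 1 = 0 → V 1 0 = N → V 1 1 = 1 → u ⟨V, hV⟩ = 0)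
    {ℓ : ℕ} [NeZero ℓ] (hℓ : ℓ.Prime) (hℓN : ¬ ℓ ∣ N) :
    heckeU 0 N R hℓ u = ((ℓ : R) + 1) • u := by
  have hL1 : N * 1 ∣ N * ℓ := by rw [mul_one]; exact Dvd.intro ℓ rfl
  have hS := shiftInvariant_of_congruence_of_killsUnipotents (M := M) hu hF hT hV hL1 (dvd_refl (N * ℓ))
  exact heckeU_eq_smul_of_shiftInvariant hℓ hℓN hL1 (dvd_refl _) (dvd_refl _) hu hS

/-- The same with the kernel form of the congruence hypothesis (`Γ₀(N) ∩ Γ(M) ⊆ ker u`, the output of the congruence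
subgroup property). [folklore] -/
theorem heckeU_eq_smul_of_killsCongruence_of_killsUnipotents [NeZero M] {u : Gamma0 N → Fin 1 → R}
    (hu : u ∈ cocycles 0 N R)
    (hKer : ∀ γ : Gamma0 N,
      (∀ i j, ((gmat γ i j : ℤ) : ZMod M) = (((1 : Matrix (Fin 2) (Fin 2) ℤ) i j : ℤ) : ZMod M)) → u γ = 0)
    (hT : ∀ (T : SL(2, ℤ)) (hT : T ∈ Gamma0 N), T 0 0 = 1 → T 0 1 = 1 → T 1 0 = 0 → T 1 1 = 1 → u ⟨T, hT⟩ = 0)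
    (hV : ∀ (V : SL(2, ℤ)) (hV : V ∈ Gamma0 N), V 0 0 = 1 → V 0 1 = 0 → V 1 0 = N → V 1 1 = 1 → u ⟨V, hV⟩ = 0)
    {ℓ : ℕ} [NeZero ℓ] (hℓ : ℓ.Prime) (hℓN : ¬ ℓ ∣ N) :
    heckeU 0 N R hℓ u = ((ℓ : R) + 1) • u :=
  heckeU_eq_smul_of_congruence_of_killsUnipotents hu (congr_of_kills_principalCongruence (M := M) hu hKer) hT hV hℓ hℓN

end Eisenstein

end Summit.BirchSwinnertonDyer.BirchSwinnertonDyer.Theorems.ManinLocalTwoThree
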